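import Literature.Geometry.Lorentzian.ChartDomainComparison
import Literature.Geometry.Lorentzian.VolumeProofs
import Literature.Analysis.FunctionSpaces.PoincareWirtingerConvex
import Literature.Analysis.FunctionSpaces.PoincareGluing
import Literature.Analysis.FluidPDE.LocalSobolevBall
import Mathlib.Geometry.Manifold.PartitionOfUnity
import HarnessLib

/-!
# Poincaré and Sobolev inequalities on chart pieces of a Riemannian manifold

The Euclidean Poincaré–Wirtinger inequality on convex sets (`PoincareWirtingerConvex.lean`) and
the local Sobolev inequality on balls (`LocalSobolevBall.lean`, dimension `3`) transplanted to the
pieces `φ⁻¹(Q)` of a chart domain of a manifold `M` with a smooth Riemannian metric `h`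
(`φ = extChartAt (𝓡 N) x`), using the uniform equivalence of `h` with the Euclidean metric on
compact parts of the chart (`ChartDomainComparison.lean`). This is the chart-by-chart step in the
standard derivation of Sobolev inequalities on (parts of) Riemannian manifolds (Hebey 1999,
§2.2 and proof of Thm. 3.5; Aubin 1998, §2.6), here in the service of Schoen–Yau 1979, Lemma 3.1.
With `μ_h` the Riemannian measure and `h⁻¹(df, df)` the Dirichlet integrand:

* `exists_contDiff_eqOn_of_isCompact` — a `Cⁿ` function on an open set of `ℝᴺ` agrees near any
  compact subset with a globally `Cⁿ` function (smooth Urysohn cut-off);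
* `exists_poincare_chartPiece` — **Poincaré–Wirtinger on a convex chart piece**: for `Q` open,
  convex, nonempty with compact closure inside the chart target there is `C < ∞` with
  `‖f − ⨍_{φ⁻¹Q} f‖_{L²(φ⁻¹Q, μ_h)} ≤ C (∫_M h⁻¹(df, df) dμ_h)^{1/2}` for all `f ∈ C¹(M)`;
* `exists_sobolev_chartBall` — **local Sobolev on a chart ball** (`N = 3`): if
  `B̄(y₀, 2r) ⊆ φ.target` there is `C < ∞` with
  `‖f‖_{L⁶(φ⁻¹B(y₀,r), μ_h)} ≤ C ((∫_M h⁻¹(df, df) dμ_h)^{1/2} + ‖f‖_{L²(M, μ_h)})` for all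
  `f ∈ C¹(M)`.

All results are proved; no named facts are introduced.

## References

* E. Hebey, *Nonlinear Analysis on Manifolds: Sobolev Spaces and Inequalities*, Courant LN 5
  (1999), §2.2, Thm. 3.5.
* R. Schoen, S.-T. Yau, Comm. Math. Phys. 65 (1979) 45–76, proof of Lemma 3.1 (p. 63).
* L. C. Evans, *Partial Differential Equations*, 2nd ed. (2010), §5.6.1, §5.8.1.
-/

noncomputable section

open Set Function Filter Metric MeasureTheory Measure TopologicalSpace Manifold Bundle Module
open scoped Topology Manifold ContDiff ENNReal NNReal

namespace Literature.Geometry.Lorentzian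

open Literature.Analysis.FunctionSpaces Literature.Analysis.FluidPDE

/-! ### Extension of `Cⁿ` functions from neighbourhoods of compact sets -/

section Extension

variable {E : Type*} [NormedAddCommGroup E] [InnerProductSpace ℝ E] [FiniteDimensional ℝ E]

/-- **A `Cⁿ` function on an open set agrees near a compact subset with a global `Cⁿ` function**:
multiply by a smooth cut-off equal to `1` near `K` and vanishing near the complement of `U`
(smooth Urysohn lemma, `exists_contMDiffMap_zero_one_nhds_of_isClosed`). [folklore] -/
theorem exists_contDiff_eqOn_of_isCompact {U K : Set E} (hU : IsOpen U) (hK : IsCompact K)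
    (hKU : K ⊆ U) {F : E → ℝ} {n : ℕ} (hF : ContDiffOn ℝ n F U) :
    ∃ G : E → ℝ, ContDiff ℝ n G ∧ ∃ V : Set E, IsOpen V ∧ K ⊆ V ∧ V ⊆ U ∧ EqOn G F V := by
  obtain ⟨χ, hχ0, hχ1, -⟩ := exists_contMDiffMap_zero_one_nhds_of_isClosed (I := 𝓘(ℝ, E)) (M := E)
    (n := ⊤) hU.isClosed_compl hK.isClosed (disjoint_compl_left_iff.2 hKU)
  have hχs : ContDiff ℝ ∞ (χ : E → ℝ) := contMDiff_iff_contDiff.1 χ.contMDiff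
  refine ⟨fun y ↦ χ y * F y, ?_, ?_⟩
  · rw [contDiff_iff_contDiffAt]
    intro y
    by_cases hy : y ∈ U
    · exact (hχs.of_le (by exact_mod_cast le_top)).contDiffAt.mul (hF.contDiffAt (hU.mem_nhds hy))
    · have hev : (fun y ↦ χ y * F y) =ᶠ[𝓝 y] fun _ ↦ 0 := by
        have h0 : ∀ᶠ z in 𝓝 y, χ z = 0 := (eventually_nhdsSet_iff_forall.1 hχ0) y hy
        filter_upwards [h0] with z hz
        rw [hz, zero_mul]
      exact contDiffAt_const.congr_of_eventuallyEq hev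
  · obtain ⟨V, hVo, hKV, hV⟩ := eventually_nhdsSet_iff_exists.1 hχ1
    refine ⟨V ∩ U, hVo.inter hU, subset_inter hKV hKU, inter_subset_right, fun y hy ↦ ?_⟩
    simp only [hV y hy.1, one_mul]

end Extension

/-! ### `L²` norms as square roots of Lebesgue integrals of squares -/

section LpAux

variable {α : Type*} [MeasurableSpace α] {μ : Measure α}

/-- `‖f‖_{L²(μ)} = (∫ ‖f‖ₑ²)^{1/2}`. [folklore] -/
private theorem eLpNorm_two_eq_lintegral_sq_rpow_half {ε : Type*} [ENorm ε] (f : α → ε) :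
    eLpNorm f 2 μ = (∫⁻ x, ‖f x‖ₑ ^ 2 ∂μ) ^ (1 / 2 : ℝ) := by
  rw [eLpNorm_eq_lintegral_rpow_enorm_toReal (by norm_num) (by norm_num), ENNReal.toReal_ofNat]
  congr 1
  refine lintegral_congr fun x ↦ ?_
  rw [show (2 : ℝ) = ((2 : ℕ) : ℝ) by norm_num, ENNReal.rpow_natCast]

/-- `‖f‖_{L²(μ)}² = ∫ ‖f‖ₑ²`. [folklore] -/
private theorem eLpNorm_two_sq_eq_lintegral {ε : Type*} [ENorm ε] (f : α → ε) :
    eLpNorm f 2 μ ^ 2 = ∫⁻ x, ‖f x‖ₑ ^ 2 ∂μ := by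
  rw [eLpNorm_two_eq_lintegral_sq_rpow_half, ← ENNReal.rpow_natCast,
    ← ENNReal.rpow_mul]
  norm_num

/-- `‖f‖_{L⁶(μ)}⁶ = ∫ ‖f‖ₑ⁶`. [folklore] -/
private theorem eLpNorm_six_pow_eq_lintegral {ε : Type*} [ENorm ε] (f : α → ε) :
    eLpNorm f 6 μ ^ 6 = ∫⁻ x, ‖f x‖ₑ ^ 6 ∂μ := by
  rw [eLpNorm_eq_lintegral_rpow_enorm_toReal (by norm_num) (by norm_num), ENNReal.toReal_ofNat,
    ← ENNReal.rpow_natCast, ← ENNReal.rpow_mul]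
  norm_num

/-- If `X² ≤ Y` in `[0, ∞]` then `X ≤ Y^{1/2}`. [folklore] -/
private theorem le_rpow_half_of_sq_le {X Y : ℝ≥0∞} (h : X ^ 2 ≤ Y) : X ≤ Y ^ (1 / 2 : ℝ) := by
  have h1 : X = (X ^ 2) ^ (1 / 2 : ℝ) := by
    rw [← ENNReal.rpow_natCast, ← ENNReal.rpow_mul]
    norm_num
  rw [h1]
  exact ENNReal.rpow_le_rpow h (by norm_num)

/-- If `X⁶ ≤ Y` in `[0, ∞]` then `X ≤ Y^{1/6}`. [folklore] -/
private theorem le_rpow_sixth_of_pow_le {X Y : ℝ≥0∞} (h : X ^ 6 ≤ Y) : X ≤ Y ^ (1 / 6 : ℝ) := by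
  have h1 : X = (X ^ 6) ^ (1 / 6 : ℝ) := by
    rw [← ENNReal.rpow_natCast, ← ENNReal.rpow_mul]
    norm_num
  rw [h1]
  exact ENNReal.rpow_le_rpow h (by norm_num)

end LpAux

/-! ### Poincaré–Wirtinger on convex chart pieces -/

section Pieces

variable {N : ℕ} {M : Type*} [TopologicalSpace M] [ChartedSpace (EuclideanSpace ℝ (Fin N)) M]
  [IsManifold (𝓡 N) ∞ M] [T2Space M] [LocallyCompactSpace M] [MeasurableSpace M] [BorelSpace M]
  (h : ContMDiffRiemannianMetric (𝓡 N) ∞ (EuclideanSpace ℝ (Fin N)) (TangentSpace (𝓡 N) : M → Type _))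
  (x : M)

/-- The chart piece over a subset of a compact part `K` of the chart target is relatively compact
(it lies in the image of `K` under the continuous inverse chart), hence of finite Riemannian
measure. [folklore] -/
theorem riemannianMeasure_source_inter_preimage_lt_top {K Q : Set (EuclideanSpace ℝ (Fin N))}
    (hK : IsCompact K) (hKt : K ⊆ (extChartAt (𝓡 N) x).target) (hQK : Q ⊆ K) :
    riemannianMeasure h ((extChartAt (𝓡 N) x).source ∩ extChartAt (𝓡 N) x ⁻¹' Q) < ⊤ := by
  have himg : IsCompact ((extChartAt (𝓡 N) x).symm '' K) :=
    hK.image_of_continuousOn ((continuousOn_extChartAt_symm x).mono hKt)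
  have hsub : (extChartAt (𝓡 N) x).source ∩ extChartAt (𝓡 N) x ⁻¹' Q ⊆
      (extChartAt (𝓡 N) x).symm '' K := by
    rintro p ⟨hp, hpQ⟩
    exact ⟨extChartAt (𝓡 N) x p, hQK hpQ, (extChartAt (𝓡 N) x).left_inv hp⟩
  exact (measure_mono hsub).trans_lt (riemannianVolume_lt_top_of_isCompact_holds h le_rfl himg)

/-- **Poincaré–Wirtinger on a convex chart piece.** Let `h` be a smooth Riemannian metric on a
manifold `M` modelled on `ℝᴺ`, `φ = extChartAt (𝓡 N) x`, and `Q ⊆ ℝᴺ` open, convex, nonempty,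
with compact closure contained in `φ.target`; put `P = φ.source ∩ φ⁻¹ Q`. There is `C < ∞` such
that for every `f ∈ C¹(M)`,
`‖f − ⨍_P f dμ_h‖_{L²(P, μ_h)} ≤ C (∫_M h⁻¹(df, df) dμ_h)^{1/2}`.
Proof: by `‖f − f_P‖ ≤ 2 ‖f − c‖` (`eLpNorm_sub_setAverage_le_two_mul`) it suffices to take for
`c` the Lebesgue average over `Q` of a global `C¹` extension `G` of `f ∘ φ⁻¹` near `Q̄`; in the
chart `dμ_h = √(det h_{ij}) dy` with `λ ≤ √(det h_{ij}) ≤ Λ` on `Q̄`, the Euclidean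
Poincaré–Wirtinger inequality on the convex set `Q` (`lintegral_enorm_sub_setAverage_sq_le`)
bounds `∫_Q |G − c|² dy` by `2ᴺ D² ∫_Q ‖DG‖² dy`, and `‖D(f ∘ φ⁻¹)‖² ≤ h⁻¹(df,df)/λ'`
(`exists_innerDual_mvfderiv_bounds`). Hebey 1999, §2.2; Evans 2010, §5.8.1.
[cite: SchoenYauPMT1979, proof of Lemma 3.1 (p. 63)] -/
theorem exists_poincare_chartPiece {Q : Set (EuclideanSpace ℝ (Fin N))} (hQo : IsOpen Q)
    (hQc : Convex ℝ Q) (hQne : Q.Nonempty) (hK : IsCompact (closure Q))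
    (hKt : closure Q ⊆ (extChartAt (𝓡 N) x).target) :
    ∃ C : ℝ≥0∞, C ≠ ⊤ ∧ ∀ f : M → ℝ, ContMDiff (𝓡 N) 𝓘(ℝ, ℝ) 1 f →
      eLpNorm (fun p ↦ f p - ⨍ q in (extChartAt (𝓡 N) x).source ∩ extChartAt (𝓡 N) x ⁻¹' Q, f q
          ∂riemannianMeasure h) 2
        ((riemannianMeasure h).restrict ((extChartAt (𝓡 N) x).source ∩ extChartAt (𝓡 N) x ⁻¹' Q)) ≤
      C * (∫⁻ p, ENNReal.ofReal ((PseudoRiemannianMetric.ofRiemannian h).innerDual p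
        (mvfderiv (𝓡 N) f p).toLinearMap (mvfderiv (𝓡 N) f p).toLinearMap) ∂riemannianMeasure h) ^
        (1 / 2 : ℝ) := by
  classical
  set g := PseudoRiemannianMetric.ofRiemannian h with hg
  set ψ := extChartAt (𝓡 N) x with hψ
  set T : Set (EuclideanSpace ℝ (Fin N)) := ψ.target with hT
  have hTo : IsOpen T := isOpen_extChartAt_target x
  set K := closure Q with hKdef
  set P : Set M := ψ.source ∩ ψ ⁻¹' Q with hP
  set μ : Measure M := riemannianMeasure h with hμ
  have hQm : MeasurableSet Q := hQo.measurableSet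
  have hQK : Q ⊆ K := subset_closure
  have hQT : Q ⊆ T := hQK.trans hKt
  have hPm : MeasurableSet P := measurableSet_source_inter_preimage_extChartAt x hQm
  have hμP : μ P ≠ ⊤ := (riemannianMeasure_source_inter_preimage_lt_top h x hK hKt hQK).ne
  -- comparison constants on `K`
  obtain ⟨lam, Lam, hlam, -, hdens⟩ := exists_sqrt_det_chartGramMatrix_bounds h x hK hKt
  obtain ⟨lam', Lam', hlam', -, hgrad⟩ := exists_innerDual_mvfderiv_bounds h x hK hKt
  -- a diameter bound for `Q`
  obtain ⟨R, hR⟩ := (Metric.isBounded_iff_subset_closedBall (0 : EuclideanSpace ℝ (Fin N))).1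
    hK.isBounded
  have hD : ∀ y ∈ Q, ∀ z ∈ Q, ‖y - z‖ ≤ 2 * |R| := by
    intro y hy z hz
    have hy' := mem_closedBall_zero_iff.1 (hR (hQK hy))
    have hz' := mem_closedBall_zero_iff.1 (hR (hQK hz))
    calc ‖y - z‖ ≤ ‖y‖ + ‖z‖ := norm_sub_le _ _
      _ ≤ 2 * |R| := by linarith [le_abs_self R]
  have hvolQ0 : (volume : Measure (EuclideanSpace ℝ (Fin N))) Q ≠ 0 :=
    (hQo.measure_pos volume hQne).ne'
  have hvolQt : (volume : Measure (EuclideanSpace ℝ (Fin N))) Q ≠ ⊤ :=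
    ((measure_mono hQK).trans_lt hK.measure_lt_top).ne
  -- the constant
  set C₀ : ℝ≥0∞ := ENNReal.ofReal Lam * ENNReal.ofReal (2 ^ finrank ℝ (EuclideanSpace ℝ (Fin N)) *
    (2 * |R|) ^ 2) * ENNReal.ofReal (1 / lam') * ENNReal.ofReal (1 / lam) with hC₀
  have hC₀t : C₀ ≠ ⊤ := by
    simp only [hC₀]
    exact ENNReal.mul_ne_top (ENNReal.mul_ne_top (ENNReal.mul_ne_top ENNReal.ofReal_ne_top
      ENNReal.ofReal_ne_top) ENNReal.ofReal_ne_top) ENNReal.ofReal_ne_top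
  refine ⟨2 * C₀ ^ (1 / 2 : ℝ), ENNReal.mul_ne_top (by norm_num)
    (ENNReal.rpow_ne_top_of_nonneg (by norm_num) hC₀t), fun f hf ↦ ?_⟩
  have hfc : Continuous f := hf.continuous
  -- the chart representative and a global `C¹` extension near `K`
  set F : EuclideanSpace ℝ (Fin N) → ℝ := f ∘ ψ.symm with hF
  have hF1 : ContDiffOn ℝ 1 F T := contDiffOn_comp_extChartAt_symm hf
  obtain ⟨G, hG1, V, hVo, hKV, hVT, hGF⟩ := exists_contDiff_eqOn_of_isCompact hTo hK hKt hF1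
  have hGFQ : ∀ y ∈ Q, G y = F y := fun y hy ↦ hGF (hKV (hQK hy))
  have hDGQ : ∀ y ∈ Q, fderiv ℝ G y = fderiv ℝ F y := by
    intro y hy
    have hev : G =ᶠ[𝓝 y] F :=
      Filter.eventuallyEq_of_mem ((hVo.mem_nhds (hKV (hQK hy)))) hGF
    exact hev.fderiv_eq
  -- the Euclidean Poincaré–Wirtinger inequality for `G` on `Q`
  have hGi : IntegrableOn G Q volume :=
    (hG1.continuous.continuousOn.integrableOn_compact hK).mono_set hQK
  have hPW := lintegral_enorm_sub_setAverage_sq_le (μ := (volume : Measure (EuclideanSpace ℝ (Fin N))))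
    hG1 hQc hQm hvolQ0 hvolQt hGi hD
  set c : ℝ := ⨍ z in Q, G z with hc
  -- integrability of `f` on `P`
  have hfi : IntegrableOn f P μ := by
    have himg : IsCompact (ψ.symm '' K) :=
      hK.image_of_continuousOn ((continuousOn_extChartAt_symm x).mono hKt)
    have hsub : P ⊆ ψ.symm '' K := by
      rintro p ⟨hp, hpQ⟩
      exact ⟨ψ p, hQK hpQ, ψ.left_inv hp⟩
    haveI : IsFiniteMeasureOnCompacts μ :=
      ⟨fun K' hK' ↦ riemannianVolume_lt_top_of_isCompact_holds h le_rfl hK'⟩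
    exact (hfc.continuousOn.integrableOn_compact himg).mono_set hsub
  -- Step A: replace the average by the constant `c`
  have hA := eLpNorm_sub_setAverage_le_two_mul (μ := μ) hμP one_le_two hfi c
  -- Step B: `‖f − c‖²_{L²(P)} ≤ C₀ ∫ h⁻¹(df, df)`
  have hB : eLpNorm (fun p ↦ f p - c) 2 (μ.restrict P) ^ 2 ≤
      C₀ * ∫⁻ p, ENNReal.ofReal (g.innerDual p (mvfderiv (𝓡 N) f p).toLinearMap
        (mvfderiv (𝓡 N) f p).toLinearMap) ∂μ := by
    rw [eLpNorm_two_sq_eq_lintegral]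
    -- to the chart
    have hmeas : Measurable fun p ↦ (‖f p - c‖ₑ : ℝ≥0∞) ^ 2 :=
      (hfc.sub continuous_const).measurable.enorm.pow_const 2
    have h1 : ∫⁻ p in P, ‖f p - c‖ₑ ^ 2 ∂μ =
        ∫⁻ y in Q, ‖F y - c‖ₑ ^ 2 * ENNReal.ofReal (Real.sqrt (chartGramMatrix h x y).det) := by
      have h := setLIntegral_source_inter_preimage_extChartAt' h x hmeas hQm hQT
      simpa only [hF, Function.comp_apply] using h
    -- density `≤ Λ`, and `F = G` on `Q`
    have h2 : ∫⁻ y in Q, ‖F y - c‖ₑ ^ 2 * ENNReal.ofReal (Real.sqrt (chartGramMatrix h x y).det) ≤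
        ENNReal.ofReal Lam * ∫⁻ y in Q, ‖G y - ⨍ z in Q, G z‖ₑ ^ 2 := by
      rw [← lintegral_const_mul' _ _ ENNReal.ofReal_ne_top]
      refine setLIntegral_mono' hQm fun y hy ↦ ?_
      rw [hGFQ y hy, ← hc, mul_comm]
      exact mul_le_mul_left (ENNReal.ofReal_le_ofReal (hdens y (hQK hy)).2) _
    -- Poincaré–Wirtinger, then back to `F` and to `h⁻¹(df, df)`
    have h3 : ∫⁻ y in Q, (‖fderiv ℝ G y‖ₑ : ℝ≥0∞) ^ 2 ≤
        ENNReal.ofReal (1 / lam') * ∫⁻ y in Q, ENNReal.ofReal (g.innerDual (ψ.symm y)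
          (mvfderiv (𝓡 N) f (ψ.symm y)).toLinearMap (mvfderiv (𝓡 N) f (ψ.symm y)).toLinearMap) := by
      rw [← lintegral_const_mul' _ _ ENNReal.ofReal_ne_top]
      refine setLIntegral_mono' hQm fun y hy ↦ ?_
      rw [hDGQ y hy]
      have hmd : MDifferentiableAt (𝓡 N) 𝓘(ℝ, ℝ) f (ψ.symm y) := hf.mdifferentiableAt one_ne_zero
      have hlow := (hgrad y (hQK hy) f hmd).1
      have h0 : 0 ≤ g.innerDual (ψ.symm y) (mvfderiv (𝓡 N) f (ψ.symm y)).toLinearMap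
          (mvfderiv (𝓡 N) f (ψ.symm y)).toLinearMap :=
        le_trans (mul_nonneg hlam'.le (sq_nonneg _)) hlow
      rw [← ofReal_norm, ← ENNReal.ofReal_pow (norm_nonneg _),
        ← ENNReal.ofReal_mul (by positivity)]
      refine ENNReal.ofReal_le_ofReal ?_
      rw [one_div, inv_mul_eq_div, le_div_iff₀ hlam', mul_comm]
      exact hlow
    have h4 : ∫⁻ y in Q, ENNReal.ofReal (g.innerDual (ψ.symm y)
          (mvfderiv (𝓡 N) f (ψ.symm y)).toLinearMap (mvfderiv (𝓡 N) f (ψ.symm y)).toLinearMap) ≤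
        ENNReal.ofReal (1 / lam) * ∫⁻ y in Q, ENNReal.ofReal (g.innerDual (ψ.symm y)
          (mvfderiv (𝓡 N) f (ψ.symm y)).toLinearMap (mvfderiv (𝓡 N) f (ψ.symm y)).toLinearMap) *
          ENNReal.ofReal (Real.sqrt (chartGramMatrix h x y).det) := by
      rw [← lintegral_const_mul' _ _ ENNReal.ofReal_ne_top]
      refine setLIntegral_mono' hQm fun y hy ↦ ?_
      have hρ := (hdens y (hQK hy)).1
      calc ENNReal.ofReal (g.innerDual (ψ.symm y) (mvfderiv (𝓡 N) f (ψ.symm y)).toLinearMap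
            (mvfderiv (𝓡 N) f (ψ.symm y)).toLinearMap)
          = ENNReal.ofReal (1 / lam) * ENNReal.ofReal lam * ENNReal.ofReal (g.innerDual (ψ.symm y)
            (mvfderiv (𝓡 N) f (ψ.symm y)).toLinearMap (mvfderiv (𝓡 N) f (ψ.symm y)).toLinearMap) := by
            rw [← ENNReal.ofReal_mul (by positivity), one_div, inv_mul_cancel₀ hlam.ne',
              ENNReal.ofReal_one, one_mul]
        _ ≤ ENNReal.ofReal (1 / lam) * (ENNReal.ofReal (g.innerDual (ψ.symm y)
            (mvfderiv (𝓡 N) f (ψ.symm y)).toLinearMap (mvfderiv (𝓡 N) f (ψ.symm y)).toLinearMap) *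
            ENNReal.ofReal (Real.sqrt (chartGramMatrix h x y).det)) := by
            rw [mul_assoc, mul_comm (ENNReal.ofReal lam)]
            gcongr
    have hmeasI : Measurable fun p ↦ ENNReal.ofReal (g.innerDual p (mvfderiv (𝓡 N) f p).toLinearMap
        (mvfderiv (𝓡 N) f p).toLinearMap) :=
      ENNReal.measurable_ofReal.comp (continuous_innerDual_mvfderiv g hf hf).measurable
    have h5 : ∫⁻ y in Q, ENNReal.ofReal (g.innerDual (ψ.symm y)
          (mvfderiv (𝓡 N) f (ψ.symm y)).toLinearMap (mvfderiv (𝓡 N) f (ψ.symm y)).toLinearMap) *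
          ENNReal.ofReal (Real.sqrt (chartGramMatrix h x y).det) =
        ∫⁻ p in P, ENNReal.ofReal (g.innerDual p (mvfderiv (𝓡 N) f p).toLinearMap
          (mvfderiv (𝓡 N) f p).toLinearMap) ∂μ :=
      (setLIntegral_source_inter_preimage_extChartAt' h x hmeasI hQm hQT).symm
    have h6 : ∫⁻ p in P, ENNReal.ofReal (g.innerDual p (mvfderiv (𝓡 N) f p).toLinearMap
          (mvfderiv (𝓡 N) f p).toLinearMap) ∂μ ≤
        ∫⁻ p, ENNReal.ofReal (g.innerDual p (mvfderiv (𝓡 N) f p).toLinearMap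
          (mvfderiv (𝓡 N) f p).toLinearMap) ∂μ := setLIntegral_le_lintegral _ _
    calc ∫⁻ p in P, ‖f p - c‖ₑ ^ 2 ∂μ
        = ∫⁻ y in Q, ‖F y - c‖ₑ ^ 2 * ENNReal.ofReal (Real.sqrt (chartGramMatrix h x y).det) := h1
      _ ≤ ENNReal.ofReal Lam * ∫⁻ y in Q, ‖G y - ⨍ z in Q, G z‖ₑ ^ 2 := h2
      _ ≤ ENNReal.ofReal Lam * (ENNReal.ofReal (2 ^ finrank ℝ (EuclideanSpace ℝ (Fin N)) *
          (2 * |R|) ^ 2) * ∫⁻ y in Q, (‖fderiv ℝ G y‖ₑ : ℝ≥0∞) ^ 2) := by gcongr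
      _ ≤ ENNReal.ofReal Lam * (ENNReal.ofReal (2 ^ finrank ℝ (EuclideanSpace ℝ (Fin N)) *
          (2 * |R|) ^ 2) * (ENNReal.ofReal (1 / lam') * (ENNReal.ofReal (1 / lam) *
          ∫⁻ p, ENNReal.ofReal (g.innerDual p (mvfderiv (𝓡 N) f p).toLinearMap
            (mvfderiv (𝓡 N) f p).toLinearMap) ∂μ))) := by
          gcongr
          exact h3.trans (mul_le_mul_right (h4.trans (by rw [h5]; gcongr)) _)
      _ = C₀ * ∫⁻ p, ENNReal.ofReal (g.innerDual p (mvfderiv (𝓡 N) f p).toLinearMap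
            (mvfderiv (𝓡 N) f p).toLinearMap) ∂μ := by
          simp only [hC₀]
          ring
  -- Step C: assemble
  calc eLpNorm (fun p ↦ f p - ⨍ q in P, f q ∂μ) 2 (μ.restrict P)
      ≤ 2 * eLpNorm (fun p ↦ f p - c) 2 (μ.restrict P) := hA
    _ ≤ 2 * (C₀ * ∫⁻ p, ENNReal.ofReal (g.innerDual p (mvfderiv (𝓡 N) f p).toLinearMap
          (mvfderiv (𝓡 N) f p).toLinearMap) ∂μ) ^ (1 / 2 : ℝ) := by
        gcongr
        exact le_rpow_half_of_sq_le hB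
    _ = 2 * C₀ ^ (1 / 2 : ℝ) * (∫⁻ p, ENNReal.ofReal (g.innerDual p (mvfderiv (𝓡 N) f p).toLinearMap
          (mvfderiv (𝓡 N) f p).toLinearMap) ∂μ) ^ (1 / 2 : ℝ) := by
        rw [ENNReal.mul_rpow_of_nonneg _ _ (by norm_num), mul_assoc]

/-! ### Transfer of integrals between a chart piece and its image -/

/-- **Zero-order transfer, chart to manifold**: on subsets `Q` of a compact part `K` of the chart
target, `∫_Q u(φ⁻¹ y) dy ≤ (1/λ) ∫_{φ⁻¹Q} u dμ_h` with `λ > 0` the lower density bound on `K`.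
[folklore] -/
theorem exists_setLIntegral_comp_symm_le {K : Set (EuclideanSpace ℝ (Fin N))} (hK : IsCompact K)
    (hKt : K ⊆ (extChartAt (𝓡 N) x).target) :
    ∃ c : ℝ≥0∞, c ≠ ⊤ ∧ ∀ (u : M → ℝ≥0∞), Measurable u → ∀ Q ⊆ K, MeasurableSet Q →
      ∫⁻ y in Q, u ((extChartAt (𝓡 N) x).symm y) ≤
        c * ∫⁻ p in (extChartAt (𝓡 N) x).source ∩ extChartAt (𝓡 N) x ⁻¹' Q, u p ∂riemannianMeasure h := by
  obtain ⟨lam, Lam, hlam, -, hdens⟩ := exists_sqrt_det_chartGramMatrix_bounds h x hK hKt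
  refine ⟨ENNReal.ofReal (1 / lam), ENNReal.ofReal_ne_top, fun u hu Q hQK hQm ↦ ?_⟩
  rw [setLIntegral_source_inter_preimage_extChartAt' h x hu hQm (hQK.trans hKt),
    ← lintegral_const_mul' _ _ ENNReal.ofReal_ne_top]
  refine setLIntegral_mono' hQm fun y hy ↦ ?_
  have hρ := (hdens y (hQK hy)).1
  calc u ((extChartAt (𝓡 N) x).symm y)
      = ENNReal.ofReal (1 / lam) * ENNReal.ofReal lam * u ((extChartAt (𝓡 N) x).symm y) := by
        rw [← ENNReal.ofReal_mul (by positivity), one_div, inv_mul_cancel₀ hlam.ne',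
          ENNReal.ofReal_one, one_mul]
    _ ≤ ENNReal.ofReal (1 / lam) * (u ((extChartAt (𝓡 N) x).symm y) *
        ENNReal.ofReal (Real.sqrt (chartGramMatrix h x y).det)) := by
        rw [mul_assoc, mul_comm (ENNReal.ofReal lam)]
        gcongr

/-- **Zero-order transfer, manifold to chart**: on subsets `Q` of a compact part `K` of the chart
target, `∫_{φ⁻¹Q} u dμ_h ≤ Λ ∫_Q u(φ⁻¹ y) dy` with `Λ` the upper density bound on `K`.
[folklore] -/
theorem exists_setLIntegral_preimage_le {K : Set (EuclideanSpace ℝ (Fin N))} (hK : IsCompact K)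
    (hKt : K ⊆ (extChartAt (𝓡 N) x).target) :
    ∃ c : ℝ≥0∞, c ≠ ⊤ ∧ ∀ (u : M → ℝ≥0∞), Measurable u → ∀ Q ⊆ K, MeasurableSet Q →
      ∫⁻ p in (extChartAt (𝓡 N) x).source ∩ extChartAt (𝓡 N) x ⁻¹' Q, u p ∂riemannianMeasure h ≤
        c * ∫⁻ y in Q, u ((extChartAt (𝓡 N) x).symm y) := by
  obtain ⟨lam, Lam, hlam, -, hdens⟩ := exists_sqrt_det_chartGramMatrix_bounds h x hK hKt
  refine ⟨ENNReal.ofReal Lam, ENNReal.ofReal_ne_top, fun u hu Q hQK hQm ↦ ?_⟩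
  rw [setLIntegral_source_inter_preimage_extChartAt' h x hu hQm (hQK.trans hKt),
    ← lintegral_const_mul' _ _ ENNReal.ofReal_ne_top]
  refine setLIntegral_mono' hQm fun y hy ↦ ?_
  rw [mul_comm]
  exact mul_le_mul_left (ENNReal.ofReal_le_ofReal (hdens y (hQK hy)).2) _

/-- **First-order transfer**: on subsets `Q` of a compact part `K` of the chart target, for every
`f ∈ C¹(M)` and every `G` whose derivative agrees with that of `f ∘ φ⁻¹` on `Q`,
`∫_Q ‖DG‖² dy ≤ c ∫_M h⁻¹(df, df) dμ_h`, `c = 1/(λ λ')` (`λ'` the ellipticity constant of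
`exists_innerDual_mvfderiv_bounds`, `λ` the lower density bound). [folklore] -/
theorem exists_setLIntegral_fderiv_sq_le {K : Set (EuclideanSpace ℝ (Fin N))} (hK : IsCompact K)
    (hKt : K ⊆ (extChartAt (𝓡 N) x).target) :
    ∃ c : ℝ≥0∞, c ≠ ⊤ ∧ ∀ f : M → ℝ, ContMDiff (𝓡 N) 𝓘(ℝ, ℝ) 1 f →
      ∀ Q ⊆ K, MeasurableSet Q → ∀ G : EuclideanSpace ℝ (Fin N) → ℝ,
      (∀ y ∈ Q, fderiv ℝ G y = fderiv ℝ (f ∘ (extChartAt (𝓡 N) x).symm) y) →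
      ∫⁻ y in Q, (‖fderiv ℝ G y‖ₑ : ℝ≥0∞) ^ 2 ≤
        c * ∫⁻ p, ENNReal.ofReal ((PseudoRiemannianMetric.ofRiemannian h).innerDual p
          (mvfderiv (𝓡 N) f p).toLinearMap (mvfderiv (𝓡 N) f p).toLinearMap) ∂riemannianMeasure h := by
  set g := PseudoRiemannianMetric.ofRiemannian h with hg
  set ψ := extChartAt (𝓡 N) x with hψ
  obtain ⟨lam', Lam', hlam', -, hgrad⟩ := exists_innerDual_mvfderiv_bounds h x hK hKt
  obtain ⟨c₀, hc₀, htr⟩ := exists_setLIntegral_comp_symm_le h x hK hKt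
  refine ⟨ENNReal.ofReal (1 / lam') * c₀, ENNReal.mul_ne_top ENNReal.ofReal_ne_top hc₀,
    fun f hf Q hQK hQm G hG ↦ ?_⟩
  have hmeasI : Measurable fun p ↦ ENNReal.ofReal (g.innerDual p (mvfderiv (𝓡 N) f p).toLinearMap
      (mvfderiv (𝓡 N) f p).toLinearMap) :=
    ENNReal.measurable_ofReal.comp (continuous_innerDual_mvfderiv g hf hf).measurable
  have h3 : ∫⁻ y in Q, (‖fderiv ℝ G y‖ₑ : ℝ≥0∞) ^ 2 ≤
      ENNReal.ofReal (1 / lam') * ∫⁻ y in Q, ENNReal.ofReal (g.innerDual (ψ.symm y)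
        (mvfderiv (𝓡 N) f (ψ.symm y)).toLinearMap (mvfderiv (𝓡 N) f (ψ.symm y)).toLinearMap) := by
    rw [← lintegral_const_mul' _ _ ENNReal.ofReal_ne_top]
    refine setLIntegral_mono' hQm fun y hy ↦ ?_
    rw [hG y hy]
    have hmd : MDifferentiableAt (𝓡 N) 𝓘(ℝ, ℝ) f (ψ.symm y) := hf.mdifferentiableAt one_ne_zero
    have hlow := (hgrad y (hQK hy) f hmd).1
    have h0 : 0 ≤ g.innerDual (ψ.symm y) (mvfderiv (𝓡 N) f (ψ.symm y)).toLinearMap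
        (mvfderiv (𝓡 N) f (ψ.symm y)).toLinearMap :=
      le_trans (mul_nonneg hlam'.le (sq_nonneg _)) hlow
    rw [← ofReal_norm, ← ENNReal.ofReal_pow (norm_nonneg _),
      ← ENNReal.ofReal_mul (by positivity)]
    refine ENNReal.ofReal_le_ofReal ?_
    rw [one_div, inv_mul_eq_div, le_div_iff₀ hlam', mul_comm]
    exact hlow
  have h4 := htr _ hmeasI Q hQK hQm
  have h6 : ∫⁻ p in ψ.source ∩ ψ ⁻¹' Q, ENNReal.ofReal (g.innerDual p (mvfderiv (𝓡 N) f p).toLinearMap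
        (mvfderiv (𝓡 N) f p).toLinearMap) ∂riemannianMeasure h ≤
      ∫⁻ p, ENNReal.ofReal (g.innerDual p (mvfderiv (𝓡 N) f p).toLinearMap
        (mvfderiv (𝓡 N) f p).toLinearMap) ∂riemannianMeasure h := setLIntegral_le_lintegral _ _
  calc ∫⁻ y in Q, (‖fderiv ℝ G y‖ₑ : ℝ≥0∞) ^ 2
      ≤ ENNReal.ofReal (1 / lam') * ∫⁻ y in Q, ENNReal.ofReal (g.innerDual (ψ.symm y)
        (mvfderiv (𝓡 N) f (ψ.symm y)).toLinearMap (mvfderiv (𝓡 N) f (ψ.symm y)).toLinearMap) := h3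
    _ ≤ ENNReal.ofReal (1 / lam') * (c₀ * ∫⁻ p, ENNReal.ofReal (g.innerDual p
        (mvfderiv (𝓡 N) f p).toLinearMap (mvfderiv (𝓡 N) f p).toLinearMap) ∂riemannianMeasure h) := by
        gcongr
        exact h4.trans (mul_le_mul_right h6 _)
    _ = _ := by rw [mul_assoc]

end Pieces

/-! ### The local Sobolev inequality on chart balls (dimension `3`) -/

section Sobolev

variable {M : Type*} [TopologicalSpace M] [ChartedSpace (EuclideanSpace ℝ (Fin 3)) M]
  [IsManifold (𝓡 3) ∞ M] [T2Space M] [LocallyCompactSpace M] [MeasurableSpace M] [BorelSpace M]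
  (h : ContMDiffRiemannianMetric (𝓡 3) ∞ (EuclideanSpace ℝ (Fin 3)) (TangentSpace (𝓡 3) : M → Type _))
  (x : M)

/-- **Local Sobolev inequality on a chart ball** (dimension `3`). Let `h` be a smooth Riemannian
metric on a `3`-manifold `M`, `φ = extChartAt (𝓡 3) x`, and `B̄(y₀, 2r) ⊆ φ.target`, `r > 0`;
put `P = φ.source ∩ φ⁻¹ B(y₀, r)`. There is `C < ∞` such that for every `f ∈ C¹(M)`,
`‖f‖_{L⁶(P, μ_h)} ≤ C ((∫_M h⁻¹(df, df) dμ_h)^{1/2} + ‖f‖_{L²(M, μ_h)})`.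
Proof: in the chart, with `G` a global `C¹` extension of `f ∘ φ⁻¹` near `B̄(y₀, 2r)`,
`∫_P |f|⁶ dμ_h ≤ Λ ∫_{B(y₀,r)} |G|⁶ dy`; the Euclidean local Sobolev inequality
(`eLpNorm_six_ball_le`: `‖G‖_{L⁶(B_r)} ≤ K(‖DG‖_{L²(B̄_{2r})} + (C/r)‖G‖_{L²(B̄_{2r})})`); and the
transfers `∫_{B̄_{2r}} ‖DG‖² ≤ c ∫ h⁻¹(df,df) dμ_h`, `∫_{B̄_{2r}} |G|² ≤ (1/λ) ∫ |f|² dμ_h`.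
Hebey 1999, proof of Thm. 3.5; Evans 2010, §5.6.1. [cite: SchoenYauPMT1979, proof of Lemma 3.1 (p. 63)] -/
theorem exists_sobolev_chartBall {y₀ : EuclideanSpace ℝ (Fin 3)} {r : ℝ} (hr : 0 < r)
    (hB : closedBall y₀ (2 * r) ⊆ (extChartAt (𝓡 3) x).target) :
    ∃ C : ℝ≥0∞, C ≠ ⊤ ∧ ∀ f : M → ℝ, ContMDiff (𝓡 3) 𝓘(ℝ, ℝ) 1 f →
      eLpNorm f 6 ((riemannianMeasure h).restrict
        ((extChartAt (𝓡 3) x).source ∩ extChartAt (𝓡 3) x ⁻¹' ball y₀ r)) ≤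
      C * ((∫⁻ p, ENNReal.ofReal ((PseudoRiemannianMetric.ofRiemannian h).innerDual p
        (mvfderiv (𝓡 3) f p).toLinearMap (mvfderiv (𝓡 3) f p).toLinearMap) ∂riemannianMeasure h) ^
        (1 / 2 : ℝ) + eLpNorm f 2 (riemannianMeasure h)) := by
  classical
  set g := PseudoRiemannianMetric.ofRiemannian h with hg
  set ψ := extChartAt (𝓡 3) x with hψ
  set T : Set (EuclideanSpace ℝ (Fin 3)) := ψ.target with hT
  have hTo : IsOpen T := isOpen_extChartAt_target x
  set K := closedBall y₀ (2 * r) with hKdef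
  have hK : IsCompact K := isCompact_closedBall _ _
  have hKt : K ⊆ T := hB
  set μ : Measure M := riemannianMeasure h with hμ
  set B₁ := ball y₀ r with hB₁
  have hB₁K : B₁ ⊆ K := ball_subset_closedBall.trans (closedBall_subset_closedBall (by linarith))
  have hB₁m : MeasurableSet B₁ := measurableSet_ball
  have hKm : MeasurableSet K := measurableSet_closedBall
  -- constants
  obtain ⟨cLam, hcLam, hup⟩ := exists_setLIntegral_preimage_le h x hK hKt
  obtain ⟨clam, hclam, hlow⟩ := exists_setLIntegral_comp_symm_le h x hK hKt
  obtain ⟨c₁, hc₁, hgradtr⟩ := exists_setLIntegral_fderiv_sq_le h x hK hKt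
  obtain ⟨C_LS, hC_LS0, hLS⟩ := LocalSobolevBall.eLpNorm_six_ball_le
    (E := EuclideanSpace ℝ (Fin 3)) (F := ℝ) finrank_euclideanSpace_fin
  set KG : ℝ≥0∞ := ((SNormLESNormFDerivOfEqConst ℝ (volume : Measure (EuclideanSpace ℝ (Fin 3))) 2 :
    ℝ≥0) : ℝ≥0∞) with hKG
  set C : ℝ≥0∞ := cLam ^ (1 / 6 : ℝ) * KG * max (c₁ ^ (1 / 2 : ℝ))
    (ENNReal.ofReal (C_LS / r) * clam ^ (1 / 2 : ℝ)) with hC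
  have hCt : C ≠ ⊤ := by
    refine ENNReal.mul_ne_top (ENNReal.mul_ne_top (ENNReal.rpow_ne_top_of_nonneg (by norm_num) hcLam)
      ENNReal.coe_ne_top) ?_
    exact (max_lt (ENNReal.rpow_ne_top_of_nonneg (by norm_num) hc₁).lt_top
      (ENNReal.mul_lt_top ENNReal.ofReal_lt_top
        (ENNReal.rpow_ne_top_of_nonneg (by norm_num) hclam).lt_top)).ne
  refine ⟨C, hCt, fun f hf ↦ ?_⟩
  have hfc : Continuous f := hf.continuous
  -- the chart representative and a global extension near `K`
  set F : EuclideanSpace ℝ (Fin 3) → ℝ := f ∘ ψ.symm with hF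
  have hF1 : ContDiffOn ℝ 1 F T := contDiffOn_comp_extChartAt_symm hf
  obtain ⟨G, hG1, V, hVo, hKV, hVT, hGF⟩ := exists_contDiff_eqOn_of_isCompact hTo hK hKt hF1
  have hGFK : ∀ y ∈ K, G y = F y := fun y hy ↦ hGF (hKV hy)
  have hDGK : ∀ y ∈ K, fderiv ℝ G y = fderiv ℝ F y := by
    intro y hy
    exact (Filter.eventuallyEq_of_mem (hVo.mem_nhds (hKV hy)) hGF).fderiv_eq
  -- (1) the left-hand side: `‖f‖_{L⁶(P)} ≤ Λ^{1/6} ‖G‖_{L⁶(B₁)}`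
  have hL : eLpNorm f 6 (μ.restrict (ψ.source ∩ ψ ⁻¹' B₁)) ≤
      cLam ^ (1 / 6 : ℝ) * eLpNorm G 6 (volume.restrict B₁) := by
    have hmeas : Measurable fun p ↦ (‖f p‖ₑ : ℝ≥0∞) ^ 6 := hfc.measurable.enorm.pow_const 6
    have h1 := hup _ hmeas B₁ hB₁K hB₁m
    have h2 : ∫⁻ y in B₁, (‖f (ψ.symm y)‖ₑ : ℝ≥0∞) ^ 6 = ∫⁻ y in B₁, (‖G y‖ₑ : ℝ≥0∞) ^ 6 :=
      setLIntegral_congr_fun hB₁m fun y hy ↦ by rw [hGFK y (hB₁K hy)]; rfl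
    have h3 : eLpNorm f 6 (μ.restrict (ψ.source ∩ ψ ⁻¹' B₁)) ^ 6 ≤
        cLam * eLpNorm G 6 (volume.restrict B₁) ^ 6 := by
      rw [eLpNorm_six_pow_eq_lintegral, eLpNorm_six_pow_eq_lintegral, ← h2]
      exact h1
    calc eLpNorm f 6 (μ.restrict (ψ.source ∩ ψ ⁻¹' B₁))
        ≤ (cLam * eLpNorm G 6 (volume.restrict B₁) ^ 6) ^ (1 / 6 : ℝ) := le_rpow_sixth_of_pow_le h3
      _ = cLam ^ (1 / 6 : ℝ) * eLpNorm G 6 (volume.restrict B₁) := by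
          rw [ENNReal.mul_rpow_of_nonneg _ _ (by norm_num), ← ENNReal.rpow_natCast,
            ← ENNReal.rpow_mul]
          norm_num
  -- (2) the Euclidean local Sobolev inequality for `G`
  have hE := hLS hG1 y₀ hr
  -- (3) the gradient term
  have hD : eLpNorm (fderiv ℝ G) 2 (volume.restrict K) ≤ c₁ ^ (1 / 2 : ℝ) *
      (∫⁻ p, ENNReal.ofReal (g.innerDual p (mvfderiv (𝓡 3) f p).toLinearMap
        (mvfderiv (𝓡 3) f p).toLinearMap) ∂μ) ^ (1 / 2 : ℝ) := by
    have h1 := hgradtr f hf K subset_rfl hKm G hDGK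
    rw [← ENNReal.mul_rpow_of_nonneg _ _ (by norm_num)]
    refine le_rpow_half_of_sq_le ?_
    rw [eLpNorm_two_sq_eq_lintegral]
    exact h1
  -- (4) the zero-order term
  have hZ : eLpNorm G 2 (volume.restrict K) ≤ clam ^ (1 / 2 : ℝ) * eLpNorm f 2 μ := by
    have hmeas : Measurable fun p ↦ (‖f p‖ₑ : ℝ≥0∞) ^ 2 := hfc.measurable.enorm.pow_const 2
    have h1 := hlow _ hmeas K subset_rfl hKm
    have h2 : ∫⁻ y in K, (‖G y‖ₑ : ℝ≥0∞) ^ 2 = ∫⁻ y in K, (‖f (ψ.symm y)‖ₑ : ℝ≥0∞) ^ 2 :=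
      setLIntegral_congr_fun hKm fun y hy ↦ by rw [hGFK y hy]; rfl
    have h3 : ∫⁻ p in ψ.source ∩ ψ ⁻¹' K, (‖f p‖ₑ : ℝ≥0∞) ^ 2 ∂μ ≤ ∫⁻ p, (‖f p‖ₑ : ℝ≥0∞) ^ 2 ∂μ :=
      setLIntegral_le_lintegral _ _
    have hsq : eLpNorm G 2 (volume.restrict K) ^ 2 ≤ clam * eLpNorm f 2 μ ^ 2 := by
      rw [eLpNorm_two_sq_eq_lintegral, eLpNorm_two_sq_eq_lintegral, h2]
      exact h1.trans (mul_le_mul_right h3 _)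
    calc eLpNorm G 2 (volume.restrict K) ≤ (clam * eLpNorm f 2 μ ^ 2) ^ (1 / 2 : ℝ) :=
          le_rpow_half_of_sq_le hsq
      _ = clam ^ (1 / 2 : ℝ) * eLpNorm f 2 μ := by
          rw [ENNReal.mul_rpow_of_nonneg _ _ (by norm_num), ← ENNReal.rpow_natCast (eLpNorm f 2 μ),
            ← ENNReal.rpow_mul]
          norm_num
  -- (5) assemble
  set DIR := (∫⁻ p, ENNReal.ofReal (g.innerDual p (mvfderiv (𝓡 3) f p).toLinearMap
    (mvfderiv (𝓡 3) f p).toLinearMap) ∂μ) ^ (1 / 2 : ℝ) with hDIR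
  set mx := max (c₁ ^ (1 / 2 : ℝ)) (ENNReal.ofReal (C_LS / r) * clam ^ (1 / 2 : ℝ)) with hmx
  calc eLpNorm f 6 (μ.restrict (ψ.source ∩ ψ ⁻¹' B₁))
      ≤ cLam ^ (1 / 6 : ℝ) * eLpNorm G 6 (volume.restrict B₁) := hL
    _ ≤ cLam ^ (1 / 6 : ℝ) * (KG * (eLpNorm (fderiv ℝ G) 2 (volume.restrict K) +
        ENNReal.ofReal (C_LS / r) * eLpNorm G 2 (volume.restrict K))) := by gcongr
    _ ≤ cLam ^ (1 / 6 : ℝ) * (KG * (c₁ ^ (1 / 2 : ℝ) * DIR +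
        ENNReal.ofReal (C_LS / r) * (clam ^ (1 / 2 : ℝ) * eLpNorm f 2 μ))) := by gcongr
    _ ≤ cLam ^ (1 / 6 : ℝ) * (KG * (mx * DIR + mx * eLpNorm f 2 μ)) := by
        have i1 : c₁ ^ (1 / 2 : ℝ) * DIR ≤ mx * DIR := mul_le_mul_left (le_max_left _ _) _
        have i2 : ENNReal.ofReal (C_LS / r) * (clam ^ (1 / 2 : ℝ) * eLpNorm f 2 μ) ≤
            mx * eLpNorm f 2 μ := by
          rw [← mul_assoc]
          exact mul_le_mul_left (le_max_right _ _) _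
        exact mul_le_mul_right (mul_le_mul_right (add_le_add i1 i2) _) _
    _ = C * (DIR + eLpNorm f 2 μ) := by
        simp only [hC, hmx]
        ring

end Sobolev



end Literature.Geometry.Lorentzian

end
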